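import Literature.Analysis.FluidPDE.KNSSLemma31Liouville
import Literature.Analysis.UnboundedOperators.HeatKernelBoundedData
import HarnessLib

/-!
# KNSS 2009, Lemma 3.1 by duality, III: assembly of the caloric part `w` and the drift `b(t)`
# from the two-time identity

Analysis/FluidPDE support file (everything proved; no named facts) on the discharge path of
`Literature.Analysis.FluidPDE.KNSS2009_weak_driftMild` through the named fact
`KNSS2009_lemma31_homogeneous` (`KNSSWeakDriftMild.lean`; Koch–Nadirashvili–Seregin–Šverák 2009,
arXiv:0709.3599v1, §3 Lemma 3.1 with `f = 0`: a bounded weak solution `z` of the homogeneous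
Stokes system on `ℝⁿ × (0, T)` is `w + b(t)` with `w` caloric and `b` bounded measurable;
Remark 3.1: "`w` and `b` are determined up to a constant"). The duality proof of the tree
(`KNSSLemma31Caloric`, `KNSSLemma31Liouville`) delivers Lemma 3.1 first as a **two-time identity**
on a set `G ⊆ (0, T)` of full measure of good times:

  `z(t) = e^{(t−s)Δ}z(s) + β(s, t)` a.e. in `x`, for `s < t` in `G`, `β(s, t) ∈ E` a constant,

which is what the printed proof obtains for the mollifications before letting `ε → 0`
("`u_ε(x,t) − w_ε(x,t) = b_ε(t)`", p. 7). This file performs the last, measure-theoretic step —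
KNSS's "compactness … the functions `b_ε` converge a.e. to an `L^∞` function `b`", replaced by an
explicit construction — for a jointly measurable bounded field `z`:

* `exists_caloric_decomposition_of_twoTime` — from the two-time identity on `G`: jointly
  measurable `w` with `w(t) = e^{(t−s)Δ}w(s)` for all `0 < s < t < T` (pointwise), `b`
  measurable, `‖w‖, ‖b‖ ≤ 3Z` (`Z` the bound of `z`), and `z(t) = w(t) + b(t)` a.e. for a.e. `t`.

## Construction

The constants are recovered as ball averages, `β(s, t) = ⨍_B (z(t) − e^{(t−s)Δ}z(s))`, which
makes `β` jointly measurable; transporting the identity by the heat flow gives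
`e^{(t−s')Δ}z(s') = e^{(t−s)Δ}z(s) + β(s, s')` for `s < s'` in `G` and every `t > s'`, whence the
**cocycle** `β(r, t) = β(r, s) + β(s, t)`. Fixing `s⋆ ∈ G`, the antiderivative
`κ(s) = −β(s, s⋆)` (`s < s⋆`), `κ(s⋆) = 0`, `κ(s) = β(s⋆, s)` (`s > s⋆`) satisfies
`κ(s') − κ(s) = β(s, s')` on `G`, so `V(s, t) = e^{(t−s)Δ}z(s) − κ(s)` does not depend on
`s ∈ G ∩ (0, t)`; the caloric part is its average over the reference time,
`w(t) = t⁻¹ ∫₀ᵗ V(s, t) ds` — equal to `V(s, t)` for *every* good `s < t`, hence caloric, and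
jointly measurable as a parametric integral — and `b = κ`: for `t ∈ G`,
`z(t) = e^{(t−s)Δ}z(s) + β(s, t) = w(t) + κ(s) + β(s, t) = w(t) + κ(t)`. Bounds:
`‖β‖ ≤ 2Z` (maximum principle `‖e^{σΔ}z(s)‖ ≤ Z`), so `‖κ‖ ≤ 2Z`, `‖w‖ ≤ 3Z`.

## Mathlib / tree search

Tree: `UnboundedOperators.heatExtension_add_holds` (semigroup law), `heatExtension_const`
(`HeatKernelBoundedData`), `heatExtension_add_eq_of_memLp` / `heatExtension_sub_eq_of_memLp`
(`MildL3Restart`), `UnboundedOperators.norm_heatExtension_le`, `memLp_heatExtension_holds`; joint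
measurability of the heat kernel by `fun_prop` (as in `KochTataruKernel.measurable_heatKernel_uncurry`,
not imported). Nothing on two-time identities or caloric decompositions
(`lean search 'twoTime|caloric_decomposition|KNSS2009_lemma31'`). Mathlib:
`StronglyMeasurable.integral_prod_right'`, `Measurable.ite`, `norm_setIntegral_le_of_norm_le_const`,
`setIntegral_const`, `integral_indicator`, `Real.volume_Ioo`, `ae_restrict_of_ae_restrict_of_subset`.

## References

* G. Koch, N. Nadirashvili, G. Seregin, V. Šverák, *Liouville theorems for the Navier–Stokes
  equations and applications*, Acta Math. 203 (2009) = arXiv:0709.3599v1, §3 Lemma 3.1, its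
  proof and Remark 3.1 (p. 7). [KochNadirashviliSereginSverak2009]
-/

noncomputable section

open MeasureTheory Set Function Filter TopologicalSpace InnerProductSpace Metric
open scoped RealInnerProductSpace ENNReal

namespace Literature.Analysis.FluidPDE

variable {E : Type*} [NormedAddCommGroup E] [InnerProductSpace ℝ E] [FiniteDimensional ℝ E]
  [MeasurableSpace E] [BorelSpace E]

/-! ### Tools: good times near `0`, a.e.-congruence of the heat flow, ball averages -/

section Tools

omit [FiniteDimensional ℝ E] [MeasurableSpace E] [BorelSpace E] in
/-- A set of full measure in `(0, T)` meets every initial window `(0, t)`, `0 < t ≤ T`. [folklore] -/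
theorem nonempty_inter_Ioo_of_ae_mem_Ioo {T : ℝ} {G : Set ℝ}
    (hG : ∀ᵐ τ ∂((volume : Measure ℝ).restrict (Ioo 0 T)), τ ∈ G) {t : ℝ} (ht : 0 < t)
    (htT : t ≤ T) : (G ∩ Ioo 0 t).Nonempty := by
  by_contra h
  rw [not_nonempty_iff_eq_empty] at h
  have h1 : ((volume : Measure ℝ).restrict (Ioo 0 T)) (Ioo 0 t) = 0 := by
    refine measure_mono_null (fun τ hτ => ?_) (ae_iff.1 hG)
    intro hτG
    have : τ ∈ G ∩ Ioo 0 t := ⟨hτG, hτ⟩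
    rw [h] at this
    exact this
  rw [Measure.restrict_apply measurableSet_Ioo,
    inter_eq_left.2 (Ioo_subset_Ioo_right htT), Real.volume_Ioo, sub_zero,
    ENNReal.ofReal_eq_zero] at h1
  linarith

/-- Almost everywhere equal data have the same caloric extension everywhere (the heat extension
is a convolution integral). The same statement is `heatExtension_eq_of_ae_eq`
(`OseenDuhamelMeasurable.lean`) and `heatExtension_congr_ae` (`MildL3Smooth.lean`), neither
imported here. [folklore] -/
theorem heatExtension_congr_of_ae_eq {F' : Type*} [NormedAddCommGroup F'] [NormedSpace ℝ F']
    {f g : E → F'} (hfg : f =ᵐ[volume] g) (t : ℝ) (x : E) :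
    UnboundedOperators.heatExtension f t x = UnboundedOperators.heatExtension g t x := by
  rw [UnboundedOperators.heatExtension_apply, UnboundedOperators.heatExtension_apply]
  refine integral_congr_ae ?_
  have h : (fun y => f (x - y)) =ᵐ[volume] fun y => g (x - y) :=
    (Measure.measurePreserving_sub_left volume x).quasiMeasurePreserving.ae_eq_comp hfg
  filter_upwards [h] with y hy
  rw [hy]

/-- **Transport of an a.e. identity `f = g + c` by the heat flow**: for bounded measurable `g`
and `σ > 0`, `e^{σΔ}f = e^{σΔ}g + c` everywhere. [folklore] -/
theorem heatExtension_eq_add_const_of_ae_eq {f g : E → E} (hg : MemLp g ∞ volume) (c : E)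
    (hfg : f =ᵐ[volume] fun x => g x + c) {σ : ℝ} (hσ : 0 < σ) (x : E) :
    UnboundedOperators.heatExtension f σ x = UnboundedOperators.heatExtension g σ x + c := by
  haveI : CompleteSpace E := FiniteDimensional.complete ℝ E
  rw [heatExtension_congr_of_ae_eq hfg σ x]
  have h := heatExtension_add_eq_of_memLp hg (memLp_top_const c) le_top hσ
  have e : (fun x => g x + c) = g + fun _ => c := rfl
  rw [e, h, Pi.add_apply, UnboundedOperators.heatExtension_const c hσ x]

/-- `e^{σΔ}(g − c) = e^{σΔ}g − c` everywhere, for bounded measurable `g` and `σ > 0`. [folklore] -/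
theorem heatExtension_sub_const {g : E → E} (hg : MemLp g ∞ volume) (c : E) {σ : ℝ} (hσ : 0 < σ)
    (x : E) :
    UnboundedOperators.heatExtension (fun y => g y - c) σ x =
      UnboundedOperators.heatExtension g σ x - c := by
  haveI : CompleteSpace E := FiniteDimensional.complete ℝ E
  have h := heatExtension_sub_eq_of_memLp hg (memLp_top_const c) le_top hσ
  have e : (fun y => g y - c) = g - fun _ => c := rfl
  rw [e, h, Pi.sub_apply, UnboundedOperators.heatExtension_const c hσ x]

/-- The unit ball of `E` has positive finite real volume. [folklore] -/
theorem volume_real_ball_pos : 0 < (volume : Measure E).real (ball (0 : E) 1) :=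
  ENNReal.toReal_pos (measure_ball_pos volume (0 : E) one_pos).ne' measure_ball_lt_top.ne

/-- **Ball average of an a.e. constant function is that constant.** [folklore] -/
theorem inv_smul_setIntegral_ball_of_ae_eq_const {f : E → E} {c : E} (h : f =ᵐ[volume] fun _ => c) :
    ((volume : Measure E).real (ball (0 : E) 1))⁻¹ • ∫ x in ball (0 : E) 1, f x = c := by
  haveI : CompleteSpace E := FiniteDimensional.complete ℝ E
  have h1 : ∫ x in ball (0 : E) 1, f x = ∫ x in ball (0 : E) 1, c :=
    setIntegral_congr_ae measurableSet_ball (h.mono fun x hx _ => hx)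
  rw [h1, setIntegral_const, smul_smul, inv_mul_cancel₀ volume_real_ball_pos.ne', one_smul]

/-- **Ball averages of bounded functions are bounded.** [folklore] -/
theorem norm_inv_smul_setIntegral_ball_le {f : E → E} {K : ℝ} (h : ∀ x, ‖f x‖ ≤ K) :
    ‖((volume : Measure E).real (ball (0 : E) 1))⁻¹ • ∫ x in ball (0 : E) 1, f x‖ ≤ K := by
  have hv := volume_real_ball_pos (E := E)
  rw [norm_smul, norm_inv, Real.norm_of_nonneg hv.le]
  have h1 := norm_setIntegral_le_of_norm_le_const (μ := (volume : Measure E))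
    (measure_ball_lt_top (x := (0 : E)) (r := 1)) (fun x _ => h x)
  calc ((volume : Measure E).real (ball (0 : E) 1))⁻¹ * ‖∫ x in ball (0 : E) 1, f x‖
      ≤ ((volume : Measure E).real (ball (0 : E) 1))⁻¹ * (K * (volume : Measure E).real (ball (0 : E) 1)) :=
        mul_le_mul_of_nonneg_left h1 (inv_nonneg.2 hv.le)
    _ = K := by field_simp

end Tools

/-! ### Joint measurability of the caloric lifts `(s, σ, x) ↦ e^{σΔ}z(s)(x)` -/

section Measurability

/-- **The caloric lifts of the slices of a jointly measurable field are jointly measurable**: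
`(s, σ, x) ↦ e^{σΔ}z(s)(x) = ∫ G_σ(y) z(s, x − y) dy` is measurable on `ℝ × ℝ × E` (junk values
for `σ ≤ 0` included; Fubini measurability of a parametric integral with jointly measurable
integrand). [folklore] -/
theorem measurable_heatExtension_slice {z : ℝ → E → E} (hzm : Measurable (uncurry z)) :
    Measurable fun p : ℝ × ℝ × E => UnboundedOperators.heatExtension (z p.1) p.2.1 p.2.2 := by
  have hK : Measurable (fun q : ℝ × E => UnboundedOperators.heatKernel q.1 q.2) := by
    unfold UnboundedOperators.heatKernel
    fun_prop
  have hF : Measurable fun r : (ℝ × ℝ × E) × E =>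
      UnboundedOperators.heatKernel r.1.2.1 r.2 • z r.1.1 (r.1.2.2 - r.2) := by
    have g1 : Measurable fun r : (ℝ × ℝ × E) × E => ((r.1.2.1, r.2) : ℝ × E) :=
      measurable_fst.snd.fst.prodMk measurable_snd
    have g2 : Measurable fun r : (ℝ × ℝ × E) × E => ((r.1.1, r.1.2.2 - r.2) : ℝ × E) :=
      measurable_fst.fst.prodMk (measurable_fst.snd.snd.sub measurable_snd)
    exact (hK.comp g1).smul (hzm.comp g2)
  have key : Measurable fun p : ℝ × ℝ × E =>
      ∫ y, UnboundedOperators.heatKernel p.2.1 y • z p.1 (p.2.2 - y) :=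
    (hF.stronglyMeasurable.integral_prod_right' (ν := (volume : Measure E))).measurable
  simp only [UnboundedOperators.heatExtension_apply]
  exact key

/-- The two-time lift `(s, t, x) ↦ e^{(t−s)Δ}z(s)(x)` is jointly measurable. [folklore] -/
theorem measurable_heatExtension_slice_sub {z : ℝ → E → E} (hzm : Measurable (uncurry z)) :
    Measurable fun p : ℝ × ℝ × E => UnboundedOperators.heatExtension (z p.1) (p.2.1 - p.1) p.2.2 := by
  have hK : Measurable (fun q : ℝ × E => UnboundedOperators.heatKernel q.1 q.2) := by
    unfold UnboundedOperators.heatKernel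
    fun_prop
  have hF : Measurable fun r : (ℝ × ℝ × E) × E =>
      UnboundedOperators.heatKernel (r.1.2.1 - r.1.1) r.2 • z r.1.1 (r.1.2.2 - r.2) := by
    have g1 : Measurable fun r : (ℝ × ℝ × E) × E => ((r.1.2.1 - r.1.1, r.2) : ℝ × E) :=
      (measurable_fst.snd.fst.sub measurable_fst.fst).prodMk measurable_snd
    have g2 : Measurable fun r : (ℝ × ℝ × E) × E => ((r.1.1, r.1.2.2 - r.2) : ℝ × E) :=
      measurable_fst.fst.prodMk (measurable_fst.snd.snd.sub measurable_snd)
    exact (hK.comp g1).smul (hzm.comp g2)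
  have key : Measurable fun p : ℝ × ℝ × E =>
      ∫ y, UnboundedOperators.heatKernel (p.2.1 - p.1) y • z p.1 (p.2.2 - y) :=
    (hF.stronglyMeasurable.integral_prod_right' (ν := (volume : Measure E))).measurable
  simp only [UnboundedOperators.heatExtension_apply]
  exact key

end Measurability

/-! ### Assembly of `w` and `b` from the two-time identity -/

section Assembly

/-- **KNSS 2009, Lemma 3.1 (`f = 0`): assembly of the caloric part and of the drift from the
two-time identity** (arXiv:0709.3599v1 p. 7, where it is obtained for the mollifications,
"`u_ε(x,t) − w_ε(x,t) = b_ε(t)`", and passed to the limit by compactness; Remark 3.1: `w` and `b`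
are determined up to a constant). Let `z : ℝ → E → E` be jointly measurable with `‖z‖ ≤ Z`, and
let `G` have full measure in `(0, T)` and carry the two-time identity: for `s < t` in `G`
there is a constant `β` with `z(t) = e^{(t−s)Δ}z(s) + β` a.e. Then there are `w : ℝ → E → E`
jointly measurable and `b : ℝ → E` measurable with `w(t) = e^{(t−s)Δ}w(s)` pointwise for all
`0 < s < t < T`, `‖w(t, x)‖ ≤ 3Z` on `(0, T) × E`, `‖b(t)‖ ≤ 3Z` for all `t`, and
`z(t) = w(t) + b(t)` a.e. for a.e. `t ∈ (0, T)`. See the module docstring for the construction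
(ball averages, the cocycle of the constants, averaging over the reference time). [cite: KochNadirashviliSereginSverak2009, Lemma 3.1 with Remark 3.1 (arXiv:0709.3599v1 p. 7)] -/
theorem exists_caloric_decomposition_of_twoTime {T Z : ℝ} (hT : 0 < T) {z : ℝ → E → E}
    (hzm : Measurable (uncurry z)) (hZ : ∀ t x, ‖z t x‖ ≤ Z) {G : Set ℝ}
    (hG : ∀ᵐ τ ∂((volume : Measure ℝ).restrict (Ioo 0 T)), τ ∈ G)
    (htwo : ∀ ⦃s⦄, s ∈ G → ∀ ⦃t⦄, t ∈ G → s < t →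
      ∃ β : E, z t =ᵐ[volume] fun x => UnboundedOperators.heatExtension (z s) (t - s) x + β) :
    ∃ (w : ℝ → E → E) (b : ℝ → E),
      Measurable (uncurry w) ∧
      (∀ s t : ℝ, 0 < s → s < t → t < T → ∀ x,
        w t x = UnboundedOperators.heatExtension (w s) (t - s) x) ∧
      (∀ t ∈ Ioo 0 T, ∀ x, ‖w t x‖ ≤ 3 * Z) ∧
      Measurable b ∧ (∀ t, ‖b t‖ ≤ 3 * Z) ∧
      ∀ᵐ t ∂((volume : Measure ℝ).restrict (Ioo 0 T)), z t =ᵐ[volume] fun x => w t x + b t := by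
  haveI : CompleteSpace E := FiniteDimensional.complete ℝ E
  have hZ0 : 0 ≤ Z := (norm_nonneg _).trans (hZ 0 0)
  -- slices
  have hsl : ∀ s, Measurable (z s) := fun s => hzm.comp (measurable_const.prodMk measurable_id)
  have hmem : ∀ s, MemLp (z s) ∞ (volume : Measure E) := fun s =>
    memLp_top_of_bound (hsl s).aestronglyMeasurable Z (Eventually.of_forall (hZ s))
  -- notation: the lift `L s t x = e^{(t−s)Δ}z(s)(x)`
  obtain ⟨L, hL_def⟩ : ∃ L : ℝ → ℝ → E → E,
      L = fun s t x => UnboundedOperators.heatExtension (z s) (t - s) x := ⟨_, rfl⟩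
  have hLZ : ∀ s t, s < t → ∀ x, ‖L s t x‖ ≤ Z := fun s t hst x => by
    rw [hL_def]
    exact UnboundedOperators.norm_heatExtension_le (hZ s) (sub_pos.2 hst) x
  have hLmem : ∀ s t, s < t → MemLp (L s t) ∞ (volume : Measure E) := fun s t hst => by
    rw [hL_def]
    exact UnboundedOperators.memLp_heatExtension_holds (hmem s) le_top (sub_pos.2 hst)
  have hLm : Measurable fun p : ℝ × ℝ × E => L p.1 p.2.1 p.2.2 := by
    rw [hL_def]
    exact measurable_heatExtension_slice_sub hzm
  -- semigroup law of the lifts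
  have hSG : ∀ s t t' : ℝ, s < t → t < t' → ∀ x,
      UnboundedOperators.heatExtension (L s t) (t' - t) x = L s t' x := by
    intro s t t' hst htt' x
    have h := UnboundedOperators.heatExtension_add_holds (F := E) (hmem s) le_top (sub_pos.2 hst)
      (sub_pos.2 htt')
    have e : t - s + (t' - t) = t' - s := by ring
    rw [hL_def]
    dsimp only
    rw [congrFun h x, e]
  -- the ball-average constants `β(s, t)`
  obtain ⟨vB, hvB_def⟩ : ∃ vB : ℝ, vB = (volume : Measure E).real (ball (0 : E) 1) := ⟨_, rfl⟩
  obtain ⟨β, hβ_def⟩ : ∃ β : ℝ → ℝ → E,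
      β = fun s t => vB⁻¹ • ∫ x in ball (0 : E) 1, (z t x - L s t x) := ⟨_, rfl⟩
  have hβm : Measurable (uncurry β) := by
    have g1 : Measurable fun r : (ℝ × ℝ) × E => ((r.1.2, r.2) : ℝ × E) :=
      measurable_fst.snd.prodMk measurable_snd
    have g2 : Measurable fun r : (ℝ × ℝ) × E => ((r.1.1, r.1.2, r.2) : ℝ × ℝ × E) :=
      measurable_fst.fst.prodMk (measurable_fst.snd.prodMk measurable_snd)
    have h1 : Measurable fun r : (ℝ × ℝ) × E => z r.1.2 r.2 - L r.1.1 r.1.2 r.2 :=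
      (hzm.comp g1).sub (hLm.comp g2)
    have h2 := (h1.stronglyMeasurable.integral_prod_right'
      (ν := (volume : Measure E).restrict (ball (0 : E) 1))).measurable
    have e : uncurry β = fun q : ℝ × ℝ => vB⁻¹ • ∫ x in ball (0 : E) 1, (z q.2 x - L q.1 q.2 x) := by
      rw [hβ_def]
      rfl
    rw [e]
    exact h2.const_smul vB⁻¹
  have hβZ : ∀ s t, s < t → ‖β s t‖ ≤ 2 * Z := fun s t hst => by
    rw [hβ_def, hvB_def]
    exact norm_inv_smul_setIntegral_ball_le fun x =>
      (norm_sub_le _ _).trans (by linarith [hZ t x, hLZ s t hst x])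
  have hβavg : ∀ s t (c : E), (fun x => z t x - L s t x) =ᵐ[volume] (fun _ => c) → β s t = c := by
    intro s t c h
    rw [hβ_def, hvB_def]
    exact inv_smul_setIntegral_ball_of_ae_eq_const h
  -- (A) the two-time identity holds with `β(s, t)`
  have hA : ∀ ⦃s⦄, s ∈ G → ∀ ⦃t⦄, t ∈ G → s < t →
      z t =ᵐ[volume] fun x => L s t x + β s t := by
    intro s hs t ht hst
    obtain ⟨β₀, hβ₀⟩ := htwo hs ht hst
    have hβ₀' : z t =ᵐ[volume] fun x => L s t x + β₀ := by
      rw [hL_def]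
      exact hβ₀
    have h1 : (fun x => z t x - L s t x) =ᵐ[volume] fun _ => β₀ := by
      filter_upwards [hβ₀'] with x hx
      rw [hx, add_sub_cancel_left]
    rw [hβavg s t β₀ h1]
    exact hβ₀'
  -- (TS) transport: `L s' t = L s t + β(s, s')` for `s < s'` in `G`, `s' < t`
  have hTS : ∀ ⦃s⦄, s ∈ G → ∀ ⦃s'⦄, s' ∈ G → s < s' → ∀ t, s' < t → ∀ x,
      L s' t x = L s t x + β s s' := by
    intro s hs s' hs' hss' t hs't x
    have h := heatExtension_eq_add_const_of_ae_eq (hLmem s s' hss') (β s s') (hA hs hs' hss')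
      (sub_pos.2 hs't) x
    have e1 : L s' t x = UnboundedOperators.heatExtension (z s') (t - s') x := by rw [hL_def]
    rw [e1, h, hSG s s' t hss' hs't x]
  -- (CC) the cocycle identity
  have hCC : ∀ ⦃r⦄, r ∈ G → ∀ ⦃s⦄, s ∈ G → ∀ ⦃t⦄, t ∈ G → r < s → s < t →
      β r t = β r s + β s t := by
    intro r hr s hs t ht hrs hst
    have h1 : (fun x => z t x - L r t x) =ᵐ[volume] fun _ => β r s + β s t := by
      filter_upwards [hA hs ht hst] with x hx
      rw [hx, hTS hr hs hrs t hst x]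
      abel
    exact hβavg r t _ h1
  -- a reference time `s⋆ ∈ G` and the antiderivative `κ`
  obtain ⟨sS, hsSG, -⟩ := nonempty_inter_Ioo_of_ae_mem_Ioo hG hT le_rfl
  obtain ⟨κ, hκ_def⟩ : ∃ κ : ℝ → E,
      κ = fun s => if s < sS then -β s sS else if s = sS then 0 else β sS s := ⟨_, rfl⟩
  have hκm : Measurable κ := by
    have g1 : Measurable fun s : ℝ => ((s, sS) : ℝ × ℝ) := measurable_id.prodMk measurable_const
    have g2 : Measurable fun s : ℝ => ((sS, s) : ℝ × ℝ) := measurable_const.prodMk measurable_id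
    have h1 : Measurable fun s : ℝ => -β s sS := (hβm.comp g1).neg
    have h2 : Measurable fun s : ℝ => β sS s := hβm.comp g2
    rw [hκ_def]
    exact Measurable.ite measurableSet_Iio h1
      (Measurable.ite (measurableSet_singleton sS) measurable_const h2)
  have hκZ : ∀ s, ‖κ s‖ ≤ 2 * Z := by
    intro s
    simp only [hκ_def]
    split_ifs with h1 h2
    · rw [norm_neg]; exact hβZ s sS h1
    · simpa using mul_nonneg zero_le_two hZ0
    · exact hβZ sS s (lt_of_le_of_ne (not_lt.1 h1) (Ne.symm h2))
  -- (AD) `κ(s') − κ(s) = β(s, s')` on `G`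
  have hAD : ∀ ⦃s⦄, s ∈ G → ∀ ⦃s'⦄, s' ∈ G → s < s' → κ s' - κ s = β s s' := by
    intro s hs s' hs' hss'
    simp only [hκ_def]
    rcases lt_trichotomy s' sS with h' | h' | h'
    · -- `s < s' < s⋆`
      rw [if_pos h', if_pos (hss'.trans h'), hCC hs hs' hsSG hss' h']
      abel
    · -- `s' = s⋆`
      subst h'
      rw [if_neg (lt_irrefl _), if_pos rfl, if_pos hss']
      abel
    · -- `s⋆ < s'`
      rw [if_neg (not_lt.2 h'.le), if_neg (ne_of_gt h')]
      rcases lt_trichotomy s sS with h'' | h'' | h''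
      · rw [if_pos h'', hCC hs hsSG hs' h'' h']
        abel
      · subst h''
        rw [if_neg (lt_irrefl _), if_pos rfl, sub_zero]
      · rw [if_neg (not_lt.2 h''.le), if_neg (ne_of_gt h''), hCC hsSG hs hs' h'' hss']
        abel
  -- (KP) `V(s, t) = L s t − κ s` does not depend on the good `s < t`
  have hKP : ∀ ⦃s⦄, s ∈ G → ∀ ⦃s'⦄, s' ∈ G → ∀ t, s < t → s' < t → ∀ x,
      L s t x - κ s = L s' t x - κ s' := by
    intro s hs s' hs' t hst hs't x
    rcases lt_trichotomy s s' with h | h | h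
    · rw [hTS hs hs' h t hs't x, ← hAD hs hs' h]
      abel
    · subst h
      rfl
    · rw [hTS hs' hs h t hst x, ← hAD hs' hs h]
      abel
  -- the caloric part: average of `V(s, t)` over the reference time `s ∈ (0, t)`
  obtain ⟨w, hw_def⟩ : ∃ w : ℝ → E → E,
      w = fun t x => t⁻¹ • ∫ s, if s ∈ Ioo 0 t then L s t x - κ s else 0 := ⟨_, rfl⟩
  have hwm : Measurable (uncurry w) := by
    have hset : MeasurableSet {r : (ℝ × E) × ℝ | r.2 ∈ Ioo 0 r.1.1} := by
      have e : {r : (ℝ × E) × ℝ | r.2 ∈ Ioo 0 r.1.1} =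
          {r | 0 < r.2} ∩ {r | r.2 < r.1.1} := by
        ext r
        simp [mem_Ioo]
      rw [e]
      exact (measurableSet_lt measurable_const measurable_snd).inter
        (measurableSet_lt measurable_snd measurable_fst.fst)
    have g1 : Measurable fun r : (ℝ × E) × ℝ => ((r.2, r.1.1, r.1.2) : ℝ × ℝ × E) :=
      measurable_snd.prodMk (measurable_fst.fst.prodMk measurable_fst.snd)
    have hV : Measurable fun r : (ℝ × E) × ℝ => L r.2 r.1.1 r.1.2 - κ r.2 :=
      (hLm.comp g1).sub (hκm.comp measurable_snd)
    have hI : Measurable fun r : (ℝ × E) × ℝ =>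
        if r.2 ∈ Ioo 0 r.1.1 then L r.2 r.1.1 r.1.2 - κ r.2 else 0 :=
      Measurable.ite hset hV measurable_const
    have h := (hI.stronglyMeasurable.integral_prod_right' (ν := (volume : Measure ℝ))).measurable
    have e : uncurry w = fun q : ℝ × E =>
        q.1⁻¹ • ∫ s, if s ∈ Ioo 0 q.1 then L s q.1 q.2 - κ s else 0 := by
      rw [hw_def]
      rfl
    rw [e]
    exact (measurable_fst.inv).smul h
  -- (W) `w(t) = L s t − κ s` for every good `s < t`, `t ≤ T`
  have hW : ∀ t, 0 < t → t ≤ T → ∀ ⦃s⦄, s ∈ G → s < t → ∀ x, w t x = L s t x - κ s := by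
    intro t ht htT s hs hst x
    have hae : ∀ᵐ σ ∂((volume : Measure ℝ).restrict (Ioo 0 t)), σ ∈ G :=
      ae_restrict_of_ae_restrict_of_subset (Ioo_subset_Ioo_right htT) hG
    have h1 : (∫ σ, if σ ∈ Ioo 0 t then L σ t x - κ σ else 0) =
        ∫ σ in Ioo 0 t, (L σ t x - κ σ) := by
      rw [← integral_indicator measurableSet_Ioo]
      congr 1
      funext σ
      by_cases hσ : σ ∈ Ioo 0 t
      · rw [if_pos hσ, indicator_of_mem hσ]
      · rw [if_neg hσ, indicator_of_notMem hσ]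
    have h2 : ∫ σ in Ioo 0 t, (L σ t x - κ σ) = ∫ σ in Ioo 0 t, (L s t x - κ s) := by
      refine setIntegral_congr_ae measurableSet_Ioo ?_
      filter_upwards [(ae_restrict_iff' measurableSet_Ioo).1 hae] with σ hσ hσm
      exact hKP (hσ hσm) hs t hσm.2 hst x
    have h3 : ∫ σ in Ioo 0 t, (L s t x - κ s) = t • (L s t x - κ s) := by
      have hv : (volume : Measure ℝ).real (Ioo 0 t) = t := by
        rw [measureReal_def, Real.volume_Ioo, sub_zero, ENNReal.toReal_ofReal ht.le]
      rw [setIntegral_const, hv]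
    rw [hw_def]
    dsimp only
    rw [h1, h2, h3, smul_smul, inv_mul_cancel₀ ht.ne', one_smul]
  refine ⟨w, κ, hwm, ?_, ?_, hκm, fun t => (hκZ t).trans (by linarith), ?_⟩
  · -- the caloric law
    intro s t hs hst htT x
    obtain ⟨s₀, hs₀G, hs₀⟩ := nonempty_inter_Ioo_of_ae_mem_Ioo hG hs (hst.le.trans htT.le)
    have e1 : w s = fun y => L s₀ s y - κ s₀ := funext fun y => hW s hs (hst.le.trans htT.le) hs₀G hs₀.2 y
    rw [hW t (hs.trans hst) htT.le hs₀G (hs₀.2.trans hst) x, e1,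
      heatExtension_sub_const (hLmem s₀ s hs₀.2) (κ s₀) (sub_pos.2 hst) x, hSG s₀ s t hs₀.2 hst x]
  · -- the bound of `w`
    intro t ht x
    obtain ⟨s₀, hs₀G, hs₀⟩ := nonempty_inter_Ioo_of_ae_mem_Ioo hG ht.1 ht.2.le
    rw [hW t ht.1 ht.2.le hs₀G hs₀.2 x]
    calc ‖L s₀ t x - κ s₀‖ ≤ ‖L s₀ t x‖ + ‖κ s₀‖ := norm_sub_le _ _
      _ ≤ Z + 2 * Z := add_le_add (hLZ s₀ t hs₀.2 x) (hκZ s₀)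
      _ = 3 * Z := by ring
  · -- `z(t) = w(t) + κ(t)` a.e. for `t ∈ G`
    have hmemT : ∀ᵐ t ∂((volume : Measure ℝ).restrict (Ioo 0 T)), t ∈ Ioo 0 T :=
      ae_restrict_mem measurableSet_Ioo
    filter_upwards [hG, hmemT] with t htG ht
    obtain ⟨s₀, hs₀G, hs₀⟩ := nonempty_inter_Ioo_of_ae_mem_Ioo hG ht.1 ht.2.le
    filter_upwards [hA hs₀G htG hs₀.2] with x hx
    rw [hx, hW t ht.1 ht.2.le hs₀G hs₀.2 x, ← hAD hs₀G htG hs₀.2]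
    abel

end Assembly

end Literature.Analysis.FluidPDE

end
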